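import Summits.BirchSwinnertonDyer.BirchSwinnertonDyer.Theorems.Rank2ObservatoryCosetWitness
import HarnessLib

/-!
# BirchSwinnertonDyer — rank ≥ 2 observatory: the coset witness for independence of THREE points

HONEST FRAMING: per-curve certified theorems and census instruments; no claim on BSD in rank ≥ 2.

`Rank2ObservatoryCosetWitness.lean` proves that two points `P₁, P₂` of an additive commutative group
`A` (the Mordell–Weil group `E(ℚ)`) are `ℤ`-independent as soon as every element of finite order is
killed by `2^u · m` (`m` odd) and the three combinations `P₁, P₂, P₁ + P₂` avoid the subgroup
`twoCoset _ u = 2•B + B[2^u]` after suitable homomorphisms (reductions modulo good primes). This file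
is the THREE-POINT version used by the rank-3 arm of the census (`Rank2ObservatoryRank3Table.lean`,
`Rank2ObservatoryRank3Census.lean`, named hypothesis `hlow : 3 ≤ rank_ℤ E(ℚ)`):

* `map_mem_twoCoset` / `not_mem_twoCoset_of_map_not_mem` — a homomorphism maps `twoCoset A u` into
  `twoCoset B u`, so a witness `φ x ∉ twoCoset B u` pulls back to `x ∉ twoCoset A u`;
* `not_mem_twoCoset_of_parity` — if the SEVEN combinations `ε₁P₁ + ε₂P₂ + ε₃P₃`,
  `ε ∈ {0,1}³ ∖ {0}`, avoid `twoCoset A u` then so does every `aP₁ + bP₂ + cP₃` with `a, b, c` not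
  all even (`twoCoset ⊇ 2•A`);
* `linearIndependent_triple_of_not_mem_twoCoset` — under the torsion annihilator hypothesis the seven
  witnesses give `LinearIndependent ℤ ![P₁, P₂, P₃]`. Proof (descent on `|a| + |b| + |c|`): a
  combination `x = aP₁ + bP₂ + cP₃` of finite order with `a, b, c` all even is `2 • y` with `y` a
  smaller combination of finite order; otherwise `x` is killed by `2^u m`, hence lies in
  `twoCoset A u` (`mem_twoCoset_of_zsmul_eq_zero`) — excluded by the parity lemma. So a dependency has
  zero coefficients. This is the classical criterion "independent modulo `2E(ℚ) +` torsion ⇒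
  independent" (Cremona 1997 §3.5; Silverman AEC VIII, proof of weak Mordell–Weil / X.1);
* `three_le_mordellWeilRank_of_linearIndependent`, `three_le_mordellWeilRank_of_cosetWitness`,
  `Rank3Row.three_le_mordellWeilRank` — with the Mordell–Weil theorem PROVED in the tree
  (`WeierstrassCurve.module_finite_point_holds`): `3 ≤ rank_ℤ E(ℚ)`.

The reduction homomorphisms, the kernel-evaluated witnesses and the per-curve certificates are in
`Rank2ObservatoryReductionWitness3.lean` and the machine-written `Rank2ObservatoryRank3KernelCerts*`.
Sorry-free; axioms `propext`, `Classical.choice`, `Quot.sound` only.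

References: J. E. Cremona, *Algorithms for Modular Elliptic Curves* (2nd ed. 1997), §3.5;
J. H. Silverman, *The Arithmetic of Elliptic Curves* (2nd ed. 2009), Prop. VII.3.1(b), Thm. VIII.6.7;
S. Siksek, Rocky Mountain J. Math. 25 (1995) 1501–1538 (infinite descent / independence via reduction).
-/

-- single-conjunct summit: `Summit.BirchSwinnertonDyer.BirchSwinnertonDyer.…` repeats the name by design
set_option linter.dupNamespace false

namespace Summit.BirchSwinnertonDyer.BirchSwinnertonDyer.Rank2Observatory

open WeierstrassCurve

/-! ### Functoriality of `twoCoset` and the parity reduction -/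

section Algebra

variable {A : Type*} [AddCommGroup A]

/-- A homomorphism maps `2•A + A[2^u]` into `2•B + B[2^u]`. [folklore] -/
theorem map_mem_twoCoset {B : Type*} [AddCommGroup B] (φ : A →+ B) {u : ℕ} {x : A}
    (hx : x ∈ twoCoset A u) : φ x ∈ twoCoset B u := by
  obtain ⟨b, c, hc, rfl⟩ := hx
  exact ⟨φ b, φ c, by rw [← map_zsmul, hc, map_zero], by rw [map_add, map_zsmul]⟩

/-- **Pull-back of a witness**: if `φ x ∉ 2•B + B[2^u]` then `x ∉ 2•A + A[2^u]`. [folklore] -/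
theorem not_mem_twoCoset_of_map_not_mem {B : Type*} [AddCommGroup B] (φ : A →+ B) {u : ℕ}
    {x : A} (h : φ x ∉ twoCoset B u) : x ∉ twoCoset A u :=
  fun hx => h (map_mem_twoCoset φ hx)

/-- `x ∈ twoCoset` and `y = x − 2•z` give `y ∈ twoCoset`. [folklore] -/
private theorem mem_twoCoset_of_eq_sub {u : ℕ} {x y z : A} (hx : x ∈ twoCoset A u)
    (e : y = x - (2 : ℤ) • z) : y ∈ twoCoset A u := by
  rw [e]
  exact sub_mem hx (two_zsmul_mem_twoCoset u z)

/-- **Parity reduction.** If the seven combinations `ε₁P₁ + ε₂P₂ + ε₃P₃`, `ε ∈ {0,1}³ ∖ {0}`, avoid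
`2•A + A[2^u]`, then so does `aP₁ + bP₂ + cP₃` for all integers `a, b, c` not all even (subtract
`2 • (⌊a/2⌋P₁ + ⌊b/2⌋P₂ + ⌊c/2⌋P₃) ∈ 2•A`). [cite: CremonaAlgorithms1997, §3.5] -/
theorem not_mem_twoCoset_of_parity {u : ℕ} {P₁ P₂ P₃ : A} (h₁ : P₁ ∉ twoCoset A u)
    (h₂ : P₂ ∉ twoCoset A u) (h₃ : P₃ ∉ twoCoset A u) (h₁₂ : P₁ + P₂ ∉ twoCoset A u)
    (h₁₃ : P₁ + P₃ ∉ twoCoset A u) (h₂₃ : P₂ + P₃ ∉ twoCoset A u)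
    (h₁₂₃ : P₁ + P₂ + P₃ ∉ twoCoset A u) {a b c : ℤ} (hodd : ¬ (2 ∣ a ∧ 2 ∣ b ∧ 2 ∣ c)) :
    a • P₁ + b • P₂ + c • P₃ ∉ twoCoset A u := by
  intro hx
  rcases Int.even_or_odd a with ⟨r, hr⟩ | ⟨r, hr⟩ <;>
    rcases Int.even_or_odd b with ⟨s, hs⟩ | ⟨s, hs⟩ <;>
    rcases Int.even_or_odd c with ⟨t, ht⟩ | ⟨t, ht⟩
  · exact hodd ⟨⟨r, by rw [hr]; ring⟩, ⟨s, by rw [hs]; ring⟩, ⟨t, by rw [ht]; ring⟩⟩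
  · exact h₃ (mem_twoCoset_of_eq_sub hx (z := r • P₁ + s • P₂ + t • P₃)
      (by rw [hr, hs, ht]; module))
  · exact h₂ (mem_twoCoset_of_eq_sub hx (z := r • P₁ + s • P₂ + t • P₃)
      (by rw [hr, hs, ht]; module))
  · exact h₂₃ (mem_twoCoset_of_eq_sub hx (z := r • P₁ + s • P₂ + t • P₃)
      (by rw [hr, hs, ht]; module))
  · exact h₁ (mem_twoCoset_of_eq_sub hx (z := r • P₁ + s • P₂ + t • P₃)
      (by rw [hr, hs, ht]; module))
  · exact h₁₃ (mem_twoCoset_of_eq_sub hx (z := r • P₁ + s • P₂ + t • P₃)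
      (by rw [hr, hs, ht]; module))
  · exact h₁₂ (mem_twoCoset_of_eq_sub hx (z := r • P₁ + s • P₂ + t • P₃)
      (by rw [hr, hs, ht]; module))
  · exact h₁₂₃ (mem_twoCoset_of_eq_sub hx (z := r • P₁ + s • P₂ + t • P₃)
      (by rw [hr, hs, ht]; module))

/-! ### The seven witnesses imply independence of three points -/

/-- **Coset witnesses ⇒ `ℤ`-independence of three points.** Let every element of finite order of
`A` be killed by `2^u * m` with `m` odd (for `A = E(ℚ)`: a torsion annihilator read off point counts
at good primes, Silverman AEC VII.3.1(b)), and let the seven combinations `ε₁P₁ + ε₂P₂ + ε₃P₃`,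
`ε ≠ 0`, lie outside `2•A + A[2^u]`. Then `P₁, P₂, P₃` are `ℤ`-linearly independent. Proof by
descent on `|a| + |b| + |c|`: a combination of finite order with all coefficients even is twice a
smaller one of finite order; one with a coefficient odd is killed by `2^u m`, so lies in
`2•A + A[2^u]`, contradicting the parity reduction. (Cremona 1997 §3.5: points independent in
`E(ℚ)/2E(ℚ)` modulo torsion are independent; Siksek 1995.)
[cite: CremonaAlgorithms1997, §3.5] [cite: SilvermanAEC2009, Prop. VII.3.1(b)] -/
theorem linearIndependent_triple_of_not_mem_twoCoset {u : ℕ} {m : ℤ} (hm : Odd m)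
    (htors : ∀ x : A, IsOfFinAddOrder x → ((2 : ℤ) ^ u * m) • x = 0) {P₁ P₂ P₃ : A}
    (h₁ : P₁ ∉ twoCoset A u) (h₂ : P₂ ∉ twoCoset A u) (h₃ : P₃ ∉ twoCoset A u)
    (h₁₂ : P₁ + P₂ ∉ twoCoset A u) (h₁₃ : P₁ + P₃ ∉ twoCoset A u)
    (h₂₃ : P₂ + P₃ ∉ twoCoset A u) (h₁₂₃ : P₁ + P₂ + P₃ ∉ twoCoset A u) :
    LinearIndependent ℤ ![P₁, P₂, P₃] := by
  -- a combination of finite order has zero coefficients (descent on the size of the coefficients)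
  have key : ∀ n : ℕ, ∀ a b c : ℤ, a.natAbs + b.natAbs + c.natAbs ≤ n →
      IsOfFinAddOrder (a • P₁ + b • P₂ + c • P₃) → a = 0 ∧ b = 0 ∧ c = 0 := by
    intro n
    induction n with
    | zero =>
      intro a b c hn _
      have ha : a.natAbs = 0 := by omega
      have hb : b.natAbs = 0 := by omega
      have hc : c.natAbs = 0 := by omega
      exact ⟨Int.natAbs_eq_zero.mp ha, Int.natAbs_eq_zero.mp hb, Int.natAbs_eq_zero.mp hc⟩
    | succ n ih =>
      intro a b c hn hfin
      by_cases hev : 2 ∣ a ∧ 2 ∣ b ∧ 2 ∣ c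
      · obtain ⟨⟨a', rfl⟩, ⟨b', rfl⟩, ⟨c', rfl⟩⟩ := hev
        rw [Int.natAbs_mul, Int.natAbs_mul, Int.natAbs_mul] at hn
        have h2 : (2 : ℤ).natAbs = 2 := rfl
        rw [h2] at hn
        have e : (2 * a') • P₁ + (2 * b') • P₂ + (2 * c') • P₃ =
            (2 : ℕ) • (a' • P₁ + b' • P₂ + c' • P₃) := by
          module
        rw [e] at hfin
        have h := ih a' b' c' (by omega) (hfin.of_nsmul two_ne_zero)
        omega
      · exact absurd (mem_twoCoset_of_zsmul_eq_zero hm (htors _ hfin))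
          (not_mem_twoCoset_of_parity h₁ h₂ h₃ h₁₂ h₁₃ h₂₃ h₁₂₃ hev)
  rw [Fintype.linearIndependent_iff]
  intro g hg i
  simp only [Fin.sum_univ_three, Matrix.cons_val_zero, Matrix.cons_val_one, Matrix.cons_val_two,
    Matrix.head_cons, Matrix.tail_cons] at hg
  have h0 := key _ (g 0) (g 1) (g 2) le_rfl (by rw [hg]; exact IsOfFinAddOrder.zero)
  fin_cases i
  · exact h0.1
  · exact h0.2.1
  · exact h0.2.2

end Algebra

/-! ### Consequence for the rank -/

section Rank

open Literature Literature.NumberTheory.EllipticCurves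

/-- **Three `ℤ`-linearly independent rational points give `rank_ℤ E(ℚ) ≥ 3`** — unconditionally:
`E(ℚ)` is a finite `ℤ`-module by the Mordell–Weil theorem PROVED in the tree
(`WeierstrassCurve.module_finite_point_holds`), so the size of an independent family is at most the
rank (`LinearIndependent.fintype_card_le_finrank`); as `two_le_mordellWeilRank_of_linearIndependent`.
[cite: SilvermanAEC2009, Thm. VIII.6.7] -/
theorem three_le_mordellWeilRank_of_linearIndependent (W : WeierstrassCurve ℚ) [W.IsElliptic]
    {P : Fin 3 → W.toAffine.Point} (hind : LinearIndependent ℤ P) : 3 ≤ W.mordellWeilRank := by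
  haveI : Module.Finite ℤ W.toAffine.Point := by convert W.module_finite_point_holds
  have h := hind.fintype_card_le_finrank
  rw [Fintype.card_fin] at h
  calc 3 ≤ Module.finrank ℤ W.toAffine.Point := h
    _ = W.mordellWeilRank := by unfold WeierstrassCurve.mordellWeilRank; congr!

/-- **Seven coset witnesses ⇒ `rank_ℤ E(ℚ) ≥ 3`**: `linearIndependent_triple_of_not_mem_twoCoset`
composed with `three_le_mordellWeilRank_of_linearIndependent`. The witnesses are stated in `E(ℚ)`
itself; a witness after reduction modulo a good prime pulls back by
`not_mem_twoCoset_of_map_not_mem`. [cite: SilvermanAEC2009, Thm. VIII.6.7]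
[cite: CremonaAlgorithms1997, §3.5] -/
theorem three_le_mordellWeilRank_of_cosetWitness (W : WeierstrassCurve ℚ) [W.IsElliptic]
    {u : ℕ} {m : ℤ} (hm : Odd m)
    (htors : ∀ x : W.toAffine.Point, IsOfFinAddOrder x → ((2 : ℤ) ^ u * m) • x = 0)
    {P₁ P₂ P₃ : W.toAffine.Point} (h₁ : P₁ ∉ twoCoset W.toAffine.Point u)
    (h₂ : P₂ ∉ twoCoset W.toAffine.Point u) (h₃ : P₃ ∉ twoCoset W.toAffine.Point u)
    (h₁₂ : P₁ + P₂ ∉ twoCoset W.toAffine.Point u)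
    (h₁₃ : P₁ + P₃ ∉ twoCoset W.toAffine.Point u)
    (h₂₃ : P₂ + P₃ ∉ twoCoset W.toAffine.Point u)
    (h₁₂₃ : P₁ + P₂ + P₃ ∉ twoCoset W.toAffine.Point u) : 3 ≤ W.mordellWeilRank :=
  three_le_mordellWeilRank_of_linearIndependent W
    (linearIndependent_triple_of_not_mem_twoCoset hm htors h₁ h₂ h₃ h₁₂ h₁₃ h₂₃ h₁₂₃)

/-- **Census form**: for a row of the rank-3 table with `check = true`, `ℤ`-independence of the
three LISTED generators `gen₁, gen₂, gen₃` gives the named hypothesis `hlow : 3 ≤ rank_ℤ E(ℚ)` of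
the row theorems `Rank3Row.rank3_lderiv_eq_zero` / `Rank3Row.analyticRank_eq_rank`, by the
Mordell–Weil theorem proved in the tree. [cite: SilvermanAEC2009, Thm. VIII.6.7] -/
theorem Rank3Row.three_le_mordellWeilRank (r : Rank3Row) (h : r.check = true)
    (hind : LinearIndependent ℤ ![r.gen₁ h, r.gen₂ h, r.gen₃ h]) :
    3 ≤ r.curve.mordellWeilRank := by
  haveI := r.isElliptic_of_delta_ne_zero (r.check_spec h).1
  exact three_le_mordellWeilRank_of_linearIndependent r.curve hind

end Rank

end Summit.BirchSwinnertonDyer.BirchSwinnertonDyer.Rank2Observatory
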